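import Mathlib.Analysis.Calculus.BumpFunction.FiniteDimension
import Mathlib.Analysis.Calculus.FDeriv.Symmetric
import Literature.Analysis.Distribution.EllipticRegularity
import Literature.Analysis.Distribution.FieldIntegrationByParts
import Literature.NumberTheory.Automorphic.ArchimedeanCalculusRegular
import HarnessLib

/-!
# Exponential coordinates on a linear real group with full Lie algebra: transport of Lie
derivatives to vector fields on `ℝ^d`

Topic `NumberTheory/Automorphic`; sequel of `ArchimedeanCalculusRegular` (von Neumann–Cartan: the
elements of `H` near `1` are exponentials of small elements of `𝔤`; Lie derivatives preserve
archimedean smoothness). Let `H ≤ GL(N, A)` be a linear real group over a finite-dimensional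
coefficient algebra whose Lie algebra `𝔤` is full (`exp (tX) ∈ H` for all `t` forces `X ∈ 𝔤`),
`ι : H → G` a homomorphism, and `B` a basis of `𝔤` indexed by `Fin d`. In the exponential
coordinates of the first kind `t ↦ exp (∑ tᵢ Bᵢ)` (`chartExp B`, with pulled-back functions
`chartFun ι B φ g t = φ (g ι(exp (∑ tᵢ Bᵢ)))`) this file PROVES:

* `exists_chartFields` — there are smooth vector fields `Ξ₁, …, Ξ_d` on ALL of `ℝ^d`
  (`Ξᵢ(0) = eᵢ`) and an open `Ω₀ ∋ 0` such that for every `φ : G → ℂ` smooth in the archimedean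
  variable, every real-linear `ℓ : ℂ → ℝ` and every `g`,
  `Ξᵢ (ℓ ∘ chartFun ι B φ g) = ℓ ∘ chartFun ι B (Bᵢ φ) g` on `Ω₀`: the right-invariant derivations
  `X ↦ (X φ)(y) = d/ds φ(y exp(sX))` become honest first-order operators in the chart (near `0`,
  `Ξᵢ(t) = ∂ₛ|₀ log (exp(∑ tⱼBⱼ) exp(sBᵢ))` read in the basis `B`; the logarithm lies in `𝔤` by
  `RealMatrixGroup.eventually_nhds_one_log_mem`, and a cut-off makes the fields global);
* `wordDeriv_chartFun_eq` / `smoothDiffOp_chartFun_eq` — hence words and constant-coefficient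
  operators in the `Ξᵢ` compute the iterated Lie derivatives `iterLieDeriv ι [B_{w₁}, …] φ` on
  `Ω₀` (in the language of `Literature/Analysis/Distribution/EllipticRegularity`: `fieldDeriv`,
  `wordDeriv`, `smoothDiffOp`), so that a function annihilated by a word operator on the group is,
  chart-wise and near every point, a solution of the corresponding differential equation on `ℝ^d`;
* `exists_leftChart` — the left translations `s ↦ exp(sX) exp(∑ tᵢBᵢ)` are re-parametrised by a
  smooth `c(s, t)` with `c(0, t) = t` near `s = 0`, `t ∈ Ω₁` (same mechanism), the input for
  differentiating `φ(g exp(sX) y)` in `s` under an integral over `y` in the chart.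

The point of the coordinates `ℝ^d = Fin d → ℝ` (rather than `𝔤` itself) is that the named facts of
`EllipticRegularity` quantify over vector spaces in `Type`.

Everything here is proved; the only definitions are `chartExp` and `chartFun`.

## References

* A. Borel, H. Jacquet, *Automorphic forms and automorphic representations*, Proc. Sympos. Pure
  Math. 33 (1979), Part 1, §1.1, §1.5 [BorelJacquetCorvallis1979].
* B. C. Hall, *Lie Groups, Lie Algebras, and Representations*, 2nd ed. (2015), Cor. 3.44–3.45,
  Thm. 3.42 [Hall2015].
* A. W. Knapp, *Lie Groups Beyond an Introduction*, 2nd ed. (2002), I.§10 (exponential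
  coordinates) [Knapp2002].
-/

noncomputable section

open scoped MatrixGroups Matrix ContDiff Topology
open Filter Set Literature.Analysis.Distribution

namespace Literature.NumberTheory.Automorphic

-- Mathlib idiom (Mathlib/Algebra/Lie/OfAssociative.lean); needed to mention Lie subalgebras of matrix algebras
attribute [local instance 100] LieRing.ofAssociativeRing

variable {A : Type*} [NormedCommRing A] [NormedAlgebra ℝ A] [NormedAlgebra ℚ A] [CompleteSpace A]
  [StarRing A] {N : Type*} [Fintype N] [DecidableEq N] {H : RealMatrixGroup A N}
  {G : Type*} [Group G] (ι : H.carrier →* G) {d : ℕ}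

/-! ### Exponential coordinates of the first kind -/

/-- Exponential coordinates of the first kind on `H` attached to a basis `B` of `𝔤`:
`chartExp B t = exp (∑ᵢ tᵢ Bᵢ) ∈ H`. Knapp 2002, I.§10; Hall 2015, Cor. 3.44. [folklore] -/
def chartExp (B : Module.Basis (Fin d) ℝ H.lie.toSubmodule) (t : Fin d → ℝ) : H.carrier :=
  H.expMem ⟨((B.equivFun.symm t : H.lie.toSubmodule) : Matrix N N A), (B.equivFun.symm t).2⟩

/-- A function on `G` read in the exponential coordinates at `g`:
`chartFun ι B φ g t = φ (g · ι (exp (∑ᵢ tᵢ Bᵢ)))`. Borel–Jacquet 1979, §1.1. [folklore] -/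
def chartFun (B : Module.Basis (Fin d) ℝ H.lie.toSubmodule) (φ : G → ℂ) (g : G)
    (t : Fin d → ℝ) : ℂ :=
  φ (g * ι (chartExp B t))

variable {ι}

/-- Unfolding `chartFun`. [folklore] -/
@[simp] theorem chartFun_apply (B : Module.Basis (Fin d) ℝ H.lie.toSubmodule) (φ : G → ℂ) (g : G)
    (t : Fin d → ℝ) : chartFun ι B φ g t = φ (g * ι (chartExp B t)) := rfl

/-- The `i`-th basis vector as an element of the Lie algebra `𝔤 = H.lie` (same matrix).
[folklore] -/
def basisLie (B : Module.Basis (Fin d) ℝ H.lie.toSubmodule) (i : Fin d) : H.lie :=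
  ⟨((B i : H.lie.toSubmodule) : Matrix N N A), (B i).2⟩

/-- `basisLie B i` has the matrix of `B i`. [folklore] -/
@[simp] theorem coe_basisLie (B : Module.Basis (Fin d) ℝ H.lie.toSubmodule) (i : Fin d) :
    ((basisLie B i : H.lie) : Matrix N N A) = ((B i : H.lie.toSubmodule) : Matrix N N A) := rfl

/-- The matrix of `chartExp B t` is `exp (∑ᵢ tᵢ Bᵢ)`. [folklore] -/
theorem coe_chartExp (B : Module.Basis (Fin d) ℝ H.lie.toSubmodule) (t : Fin d → ℝ) :
    (((chartExp B t : H.carrier) : GL N A) : Matrix N N A) =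
      NormedSpace.exp (((B.equivFun.symm t : H.lie.toSubmodule)) : Matrix N N A) := rfl

/-- `chartExp B 0 = 1`. [folklore] -/
@[simp] theorem chartExp_zero (B : Module.Basis (Fin d) ℝ H.lie.toSubmodule) :
    chartExp B 0 = 1 := by
  refine Subtype.ext (Units.ext ?_)
  rw [coe_chartExp, map_zero, ZeroMemClass.coe_zero, NormedSpace.exp_zero]
  rfl

set_option backward.isDefEq.respectTransparency false in
open scoped Matrix.Norms.Operator in
/-- `t ↦ chartExp B t` is continuous. [folklore] -/
theorem continuous_chartExp [FiniteDimensional ℝ A] (B : Module.Basis (Fin d) ℝ H.lie.toSubmodule) :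
    Continuous (chartExp B) := by
  have hΛ : Continuous fun t : Fin d → ℝ => (B.equivFun.symm t : H.lie.toSubmodule) :=
    (B.equivFun.symm : (Fin d → ℝ) →ₗ[ℝ] H.lie.toSubmodule).continuous_of_finiteDimensional
  exact H.continuous_expMem_mk.comp hΛ

set_option backward.isDefEq.respectTransparency false in
open scoped Matrix.Norms.Operator in
/-- A function smooth in the archimedean variable is smooth in exponential coordinates:
`t ↦ φ (g ι(exp (∑ tᵢ Bᵢ)))` is `C^∞` on `ℝ^d`. Borel–Jacquet 1979, §1.1. [folklore] -/
theorem contDiff_chartFun [FiniteDimensional ℝ A] (B : Module.Basis (Fin d) ℝ H.lie.toSubmodule)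
    {φ : G → ℂ} (hφ : IsArchSmooth ι φ) (g : G) : ContDiff ℝ ∞ (chartFun ι B φ g) := by
  have hΛ : ContDiff ℝ ∞ fun t : Fin d → ℝ => (B.equivFun.symm t : H.lie.toSubmodule) :=
    (LinearMap.toContinuousLinearMap
      (B.equivFun.symm : (Fin d → ℝ) →ₗ[ℝ] H.lie.toSubmodule)).contDiff
  exact (hφ g).comp hΛ

/-- `ℓ ∘ chartFun` is smooth for a continuous real-linear `ℓ : ℂ → ℝ`. [folklore] -/
theorem contDiff_comp_chartFun [FiniteDimensional ℝ A]
    (B : Module.Basis (Fin d) ℝ H.lie.toSubmodule) {φ : G → ℂ} (hφ : IsArchSmooth ι φ)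
    (ℓ : ℂ →L[ℝ] ℝ) (g : G) : ContDiff ℝ ∞ fun t => ℓ (chartFun ι B φ g t) :=
  ℓ.contDiff.comp (contDiff_chartFun B hφ g)

/-! ### A smooth local logarithm, smooth on a neighbourhood of `1` -/

section Log

variable {A : Type*} [NormedCommRing A] [NormedAlgebra ℝ A] [CompleteSpace A]
  {N : Type*} [Fintype N] [DecidableEq N]

set_option backward.isDefEq.respectTransparency false in
open scoped Matrix.Norms.Operator in
/-- **A local logarithm, smooth on a whole neighbourhood of `1`**, inverse to `exp` on both sides
(inverse function theorem at `0` for the ANALYTIC map `exp`, so that the local inverse is `C^ω` at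
`1`, hence `C^∞` at every point near `1`). Knapp 2002, 0.§3. [folklore] -/
theorem exists_log_contDiffAt_nhds_one :
    ∃ log : Matrix N N A → Matrix N N A,
      (∀ᶠ y in 𝓝 (1 : Matrix N N A), ContDiffAt ℝ ∞ log y) ∧
      (∀ᶠ y in 𝓝 (1 : Matrix N N A), NormedSpace.exp (log y) = y) ∧
        ∀ᶠ x in 𝓝 (0 : Matrix N N A), log (NormedSpace.exp x) = x := by
  have hexp : ContDiffAt ℝ ω (NormedSpace.exp : Matrix N N A → Matrix N N A) 0 :=
    (NormedSpace.exp_analytic (𝕂 := ℝ) (0 : Matrix N N A)).contDiffAt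
  have hexp0 : HasFDerivAt (NormedSpace.exp : Matrix N N A → Matrix N N A)
      ((ContinuousLinearEquiv.refl ℝ (Matrix N N A) : Matrix N N A ≃L[ℝ] Matrix N N A) :
        Matrix N N A →L[ℝ] Matrix N N A) 0 :=
    (hasFDerivAt_exp_zero (𝕂 := ℝ) (𝔸 := Matrix N N A)).congr_fderiv (by ext M; simp)
  have hn : (ω : WithTop ℕ∞) ≠ 0 := by simp
  refine ⟨hexp.localInverse hexp0 hn, ?_, ?_, ?_⟩
  · have h1 := hexp.to_localInverse hexp0 hn
    rw [NormedSpace.exp_zero] at h1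
    filter_upwards [h1.eventually (by simp)] with y hy using hy.of_le le_top
  · have := (hexp.hasStrictFDerivAt' hexp0 hn).eventually_right_inverse
    rwa [NormedSpace.exp_zero] at this
  · exact (hexp.hasStrictFDerivAt' hexp0 hn).eventually_left_inverse

end Log

/-! ### The vector fields of the exponential chart -/

set_option backward.isDefEq.respectTransparency false in
open scoped Matrix.Norms.Operator in
/-- **The right-invariant derivations in exponential coordinates.** Let `H` have full Lie algebra
over a finite-dimensional coefficient algebra and let `B` be a basis of `𝔤` indexed by `Fin d`. There
are smooth vector fields `Ξ₁, …, Ξ_d` on `ℝ^d` with `Ξᵢ(0) = eᵢ` and an open neighbourhood `Ω₀` of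
`0` such that for every `φ : G → ℂ` smooth in the archimedean variable, every continuous real-linear
`ℓ : ℂ → ℝ`, every `g ∈ G`, every `i` and every `t ∈ Ω₀`:
`Ξᵢ (ℓ ∘ chartFun ι B φ g) (t) = ℓ ((Bᵢ φ)(g ι(chartExp B t)))`. Near `0` one takes
`Ξᵢ(t) = ∂ₛ|₀ B⁻¹ π log (exp(∑ tⱼBⱼ) exp(sBᵢ))` (`log` a local logarithm smooth near `1`, `π` a linear
projection onto `𝔤`): the logarithm lies in `𝔤` and exponentiates back
(`RealMatrixGroup.eventually_nhds_one_log_mem`), so `chartExp B` of that curve is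
`chartExp B t · exp(sBᵢ)` and the chain rule gives the claim; a bump function makes `Ξᵢ` global.
Hall 2015, Cor. 3.44–3.45; Knapp 2002, I.§10; Borel–Jacquet 1979, §1.5. [cite: Hall2015, Cor. 3.44] -/
theorem exists_chartFields [FiniteDimensional ℝ A]
    (hreg : ∀ X : Matrix N N A, (∀ t : ℝ, expGL (t • X) ∈ H.carrier) → X ∈ H.lie)
    (B : Module.Basis (Fin d) ℝ H.lie.toSubmodule) :
    ∃ (Ξ : Fin d → (Fin d → ℝ) → (Fin d → ℝ)) (Ω₀ : Set (Fin d → ℝ)),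
      (∀ i, ContDiff ℝ ∞ (Ξ i)) ∧ (∀ i, Ξ i 0 = Pi.single i 1) ∧ IsOpen Ω₀ ∧
      (0 : Fin d → ℝ) ∈ Ω₀ ∧
      ∀ (φ : G → ℂ), IsArchSmooth ι φ → ∀ (ℓ : ℂ →L[ℝ] ℝ) (g : G) (i : Fin d), ∀ t ∈ Ω₀,
        fieldDeriv (Ξ i) (fun t => ℓ (chartFun ι B φ g t)) t =
          ℓ (lieDeriv ι (basisLie B i) φ (g * ι (chartExp B t))) := by
  -- the linear chart `Λ : ℝ^d ≃ 𝔤` and a continuous linear projection `π : 𝔤𝔩 → 𝔤`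
  set Λ : (Fin d → ℝ) →L[ℝ] H.lie.toSubmodule :=
    LinearMap.toContinuousLinearMap
      (B.equivFun.symm : (Fin d → ℝ) →ₗ[ℝ] H.lie.toSubmodule) with hΛ_def
  set Λi : H.lie.toSubmodule →L[ℝ] (Fin d → ℝ) :=
    LinearMap.toContinuousLinearMap
      (B.equivFun : H.lie.toSubmodule →ₗ[ℝ] (Fin d → ℝ)) with hΛi_def
  have hΛiΛ : ∀ t, Λi (Λ t) = t := fun t => B.equivFun.apply_symm_apply t
  have hΛΛi : ∀ Y, Λ (Λi Y) = Y := fun Y => B.equivFun.symm_apply_apply Y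
  have hΛ_chart : ∀ u, chartExp B u = H.expMem ⟨((Λ u : H.lie.toSubmodule) : Matrix N N A),
      (Λ u).2⟩ := fun u => rfl
  obtain ⟨q, hpq⟩ := Submodule.exists_isCompl (H.lie.toSubmodule : Submodule ℝ (Matrix N N A))
  let πl : Matrix N N A →ₗ[ℝ] H.lie.toSubmodule := H.lie.toSubmodule.projectionOnto q hpq
  let π : Matrix N N A →L[ℝ] H.lie.toSubmodule := ⟨πl, πl.continuous_of_finiteDimensional⟩
  have hπ : ∀ {x : Matrix N N A} (hx : x ∈ H.lie.toSubmodule), π x = ⟨x, hx⟩ := fun hx =>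
    Submodule.projectionOnto_apply_of_mem_left hpq hx
  -- the logarithm and the exponential
  obtain ⟨log, hlogsm, -, hleft⟩ := exists_log_contDiffAt_nhds_one (A := A) (N := N)
  have hexp : ContDiff ℝ ∞ (NormedSpace.exp : Matrix N N A → Matrix N N A) :=
    contDiff_iff_contDiffAt.2 fun M => (NormedSpace.exp_analytic (𝕂 := ℝ) M).contDiffAt
  have hsub : ContDiff ℝ ∞ (fun Y : H.lie.toSubmodule => (Y : Matrix N N A)) :=
    H.lie.toSubmodule.subtypeL.contDiff
  -- the basis vectors as elements of the Lie algebra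
  set X : Fin d → H.lie := fun i => basisLie B i with hX_def
  have hexpX : ∀ (i : Fin d) (s : ℝ), H.expMem (s • X i) =
      H.expMem ⟨(((s • B i : H.lie.toSubmodule)) : Matrix N N A), (s • B i).2⟩ := fun i s => rfl
  have hexpX0 : ∀ i : Fin d, H.expMem ((0 : ℝ) • X i) = 1 := fun i => by
    refine Subtype.ext (Units.ext ?_)
    change NormedSpace.exp ((((0 : ℝ) • X i : H.lie)) : Matrix N N A) = 1
    rw [show ((((0 : ℝ) • X i : H.lie)) : Matrix N N A) = (0 : ℝ) • (X i : Matrix N N A) from rfl,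
      zero_smul, NormedSpace.exp_zero]
  -- `P i (t, s) = exp(Λ t) exp(s Bᵢ)` as a matrix, `Q i (t, s)` the same element of `H`,
  -- `F i (t, s) = Λ⁻¹ π log (P i (t, s)) ∈ ℝ^d`
  set P : Fin d → (Fin d → ℝ) × ℝ → Matrix N N A := fun i p =>
    NormedSpace.exp ((Λ p.1 : H.lie.toSubmodule) : Matrix N N A) *
      NormedSpace.exp (p.2 • (X i : Matrix N N A)) with hP_def
  set Q : Fin d → (Fin d → ℝ) × ℝ → H.carrier := fun i p => chartExp B p.1 * H.expMem (p.2 • X i)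
    with hQ_def
  have hPQ : ∀ i p, (((Q i p : H.carrier) : GL N A) : Matrix N N A) = P i p := fun i p => rfl
  set F : Fin d → (Fin d → ℝ) × ℝ → (Fin d → ℝ) := fun i p => Λi (π (log (P i p))) with hF_def
  have hPc : ∀ i, ContDiff ℝ ∞ (P i) := fun i =>
    (hexp.comp (hsub.comp (Λ.contDiff.comp contDiff_fst))).mul
      (hexp.comp (contDiff_snd.smul contDiff_const))
  have hQc : ∀ i, Continuous (Q i) := fun i =>
    ((continuous_chartExp B).comp continuous_fst).mul
      ((continuous_expMem_smul (X i)).comp continuous_snd)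
  have hQ0 : ∀ i, Q i 0 = 1 := fun i => by
    simp only [hQ_def, Prod.fst_zero, Prod.snd_zero, chartExp_zero, one_mul]
    exact hexpX0 i
  -- the good neighbourhood of `(0, 0)`
  have hgood : ∀ᶠ p in 𝓝 (0 : (Fin d → ℝ) × ℝ),
      (∀ i, ContDiffAt ℝ ∞ log (P i p)) ∧
      (∀ i, log (P i p) ∈ H.lie ∧ expGL (log (P i p)) = ((Q i p : H.carrier) : GL N A)) ∧
      log (NormedSpace.exp ((Λ p.1 : H.lie.toSubmodule) : Matrix N N A)) =
        ((Λ p.1 : H.lie.toSubmodule) : Matrix N N A) := by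
    refine (eventually_all.2 fun i => ?_).and ((eventually_all.2 fun i => ?_).and ?_)
    · have ht : Tendsto (P i) (𝓝 0) (𝓝 1) := by
        have h1 := (hPc i).continuous.tendsto 0
        have h0 : P i 0 = 1 := by rw [← hPQ, hQ0]; rfl
        rwa [h0] at h1
      exact ht.eventually hlogsm
    · have ht : Tendsto (Q i) (𝓝 0) (𝓝 1) := by
        have := (hQc i).tendsto 0
        rwa [hQ0 i] at this
      exact ht.eventually (H.eventually_nhds_one_log_mem hreg hleft)
    · have hc : Continuous fun p : (Fin d → ℝ) × ℝ =>
          ((Λ p.1 : H.lie.toSubmodule) : Matrix N N A) :=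
        continuous_subtype_val.comp (Λ.continuous.comp continuous_fst)
      have ht : Tendsto (fun p : (Fin d → ℝ) × ℝ => ((Λ p.1 : H.lie.toSubmodule) : Matrix N N A))
          (𝓝 0) (𝓝 0) := by
        have := hc.tendsto 0
        simpa using this
      exact ht.eventually hleft
  obtain ⟨ρ, hρ, hρgood⟩ := Metric.eventually_nhds_iff_ball.1 hgood
  -- `F i` is smooth on the ball
  have hFsm : ∀ i, ∀ p ∈ Metric.ball (0 : (Fin d → ℝ) × ℝ) ρ, ContDiffAt ℝ ∞ (F i) p :=
    fun i p hp => Λi.contDiff.contDiffAt.comp p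
      (π.contDiff.contDiffAt.comp p (((hρgood p hp).1 i).comp p (hPc i).contDiffAt))
  have hball_t : ∀ {t : Fin d → ℝ} {s : ℝ}, ‖t‖ < ρ → |s| < ρ →
      ((t, s) : (Fin d → ℝ) × ℝ) ∈ Metric.ball (0 : (Fin d → ℝ) × ℝ) ρ := by
    intro t s ht hs
    rw [Metric.mem_ball, dist_zero_right, Prod.norm_def, max_lt_iff]
    exact ⟨ht, by simpa [Real.norm_eq_abs] using hs⟩
  -- the fields before cut-off, smooth on the ball
  set Ξ₀ : Fin d → (Fin d → ℝ) → (Fin d → ℝ) := fun i t =>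
    fderiv ℝ (fun s : ℝ => F i (t, s)) 0 1 with hΞ₀_def
  have hΞ₀sm : ∀ i, ∀ t : Fin d → ℝ, ‖t‖ < ρ → ContDiffAt ℝ ∞ (Ξ₀ i) t := by
    intro i t ht
    have hmem := hball_t (s := 0) ht (by simpa using hρ)
    have hA : ContDiffAt ℝ ∞ (Function.uncurry fun (t : Fin d → ℝ) (s : ℝ) => F i (t, s))
        (t, 0) := by
      have : (Function.uncurry fun (t : Fin d → ℝ) (s : ℝ) => F i (t, s)) = F i := by
        funext p; rfl
      rw [this]
      exact hFsm i _ hmem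
    have hB : ContDiffAt ℝ ∞ (fun t : Fin d → ℝ => fderiv ℝ (fun s : ℝ => F i (t, s)) 0) t :=
      ContDiffAt.fderiv (𝕜 := ℝ) (n := ∞) (m := ∞) (f := fun t s => F i (t, s))
        (g := fun _ => (0 : ℝ)) hA contDiffAt_const (le_of_eq rfl)
    exact hB.clm_apply contDiffAt_const
  -- the cut-off and the global fields
  let χ : ContDiffBump (0 : Fin d → ℝ) := ⟨ρ / 4, ρ / 2, by positivity, by linarith⟩
  have hχ_one : ∀ t : Fin d → ℝ, ‖t‖ < ρ / 4 → χ t = 1 := fun t ht =>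
    χ.one_of_mem_closedBall (by rw [Metric.mem_closedBall, dist_zero_right]; exact ht.le)
  refine ⟨fun i t => χ t • Ξ₀ i t, Metric.ball 0 (ρ / 4), fun i => ?_, fun i => ?_,
    Metric.isOpen_ball, Metric.mem_ball_self (by positivity), ?_⟩
  · -- smoothness of `χ • Ξ₀ i`
    refine contDiff_iff_contDiffAt.2 fun t => ?_
    by_cases ht : ‖t‖ < ρ
    · exact (χ.contDiff.contDiffAt).smul (hΞ₀sm i t ht)
    · have hnot : t ∉ tsupport (χ : (Fin d → ℝ) → ℝ) := by
        rw [χ.tsupport_eq, Metric.mem_closedBall, dist_zero_right, not_le]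
        change ρ / 2 < ‖t‖
        linarith [not_lt.1 ht]
      have hev : (fun t => χ t • Ξ₀ i t) =ᶠ[𝓝 t] fun _ => 0 := by
        filter_upwards [notMem_tsupport_iff_eventuallyEq.1 hnot] with y hy
        simp [hy]
      exact (contDiffAt_const (c := (0 : Fin d → ℝ))).congr_of_eventuallyEq hev
  · -- `Ξ i 0 = eᵢ`
    change χ 0 • Ξ₀ i 0 = Pi.single i 1
    rw [hχ_one 0 (by simpa using (by positivity : (0 : ℝ) < ρ / 4)), one_smul, hΞ₀_def]
    change fderiv ℝ (fun s : ℝ => F i (0, s)) 0 1 = Pi.single i 1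
    -- near `0`, `F i (0, s) = s • eᵢ`
    have hev : (fun s : ℝ => F i (0, s)) =ᶠ[𝓝 0] fun s => s • (Pi.single i 1 : Fin d → ℝ) := by
      have hc : Continuous fun s : ℝ => s • (X i : Matrix N N A) := continuous_id.smul continuous_const
      have ht : Tendsto (fun s : ℝ => s • (X i : Matrix N N A)) (𝓝 0) (𝓝 0) := by
        have := hc.tendsto 0
        simpa using this
      filter_upwards [ht.eventually hleft] with s hs
      change Λi (π (log (P i (0, s)))) = s • (Pi.single i 1 : Fin d → ℝ)
      have hP0 : P i (0, s) = NormedSpace.exp (s • (X i : Matrix N N A)) := by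
        simp only [hP_def, map_zero, ZeroMemClass.coe_zero, NormedSpace.exp_zero, one_mul]
      rw [hP0, hs]
      have hmem : s • (X i : Matrix N N A) ∈ H.lie.toSubmodule :=
        H.lie.toSubmodule.smul_mem s (B i).2
      rw [hπ hmem]
      have : (⟨s • (X i : Matrix N N A), hmem⟩ : H.lie.toSubmodule) = s • B i := rfl
      rw [this, map_smul]
      congr 1
      change B.equivFun (B i) = Pi.single i 1
      funext j
      rw [B.equivFun_self, Pi.single_apply]
      rcases eq_or_ne i j with h | h
      · simp [h]
      · simp [h, h.symm]
    rw [hev.fderiv_eq]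
    have hd : HasDerivAt (fun s : ℝ => s • (Pi.single i 1 : Fin d → ℝ)) (Pi.single i 1) 0 := by
      simpa using (hasDerivAt_id (0 : ℝ)).smul_const (Pi.single i (1 : ℝ) : Fin d → ℝ)
    rw [fderiv_apply_one_eq_deriv, hd.deriv]
  · -- the identity on `Ω₀`
    intro φ hφ ℓ g i t ht
    rw [Metric.mem_ball, dist_zero_right] at ht
    have htρ : ‖t‖ < ρ := by linarith
    have ht0 := hball_t (s := 0) htρ (by simpa using hρ)
    set f : (Fin d → ℝ) → ℝ := fun t => ℓ (chartFun ι B φ g t) with hf_def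
    have hfs : ContDiff ℝ ∞ f := contDiff_comp_chartFun B hφ ℓ g
    set c : ℝ → (Fin d → ℝ) := fun s => F i (t, s) with hc_def
    -- `c 0 = t`
    have hc0 : c 0 = t := by
      change Λi (π (log (P i (t, 0)))) = t
      have hP0 : P i (t, 0) = NormedSpace.exp ((Λ t : H.lie.toSubmodule) : Matrix N N A) := by
        simp only [hP_def, zero_smul, NormedSpace.exp_zero, mul_one]
      rw [hP0, (hρgood _ ht0).2.2, hπ (Λ t).2]
      exact hΛiΛ t
    have hcd : DifferentiableAt ℝ c 0 :=
      ((hFsm i _ ht0).differentiableAt (by simp)).comp (0 : ℝ)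
        ((differentiableAt_const _).prodMk differentiableAt_id)
    -- the field at `t` is the velocity of `c`
    have hΞt : χ t • Ξ₀ i t = deriv c 0 := by
      rw [hχ_one t ht, one_smul, hΞ₀_def]
      exact fderiv_apply_one_eq_deriv
    -- the composite `f ∘ c` is `s ↦ ℓ (φ (g ι(chartExp B t) ι(exp sBᵢ)))` near `0`
    set g' : G := g * ι (chartExp B t) with hg'
    set γ : ℝ → ℂ := fun s => φ (g' * ι (H.expMem (s • X i))) with hγ_def
    have hkey : ∀ s : ℝ, ((t, s) : (Fin d → ℝ) × ℝ) ∈ Metric.ball (0 : (Fin d → ℝ) × ℝ) ρ →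
        chartExp B (F i (t, s)) = chartExp B t * H.expMem (s • X i) := by
      intro s hs
      obtain ⟨hmem, hexplog⟩ := (hρgood _ hs).2.1 i
      refine Subtype.ext (Units.ext ?_)
      have h1 : Λ (F i (t, s)) = ⟨log (P i (t, s)), hmem⟩ := by
        change Λ (Λi (π (log (P i (t, s))))) = _
        rw [hΛΛi, hπ hmem]
      rw [hΛ_chart, RealMatrixGroup.coe_expMem]
      change (expGL (((Λ (F i (t, s)) : H.lie.toSubmodule)) : Matrix N N A) : Matrix N N A) = _
      rw [h1]
      change (expGL (log (P i (t, s))) : Matrix N N A) = (((Q i (t, s) : H.carrier) : GL N A) : Matrix N N A)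
      rw [hexplog]
    have hts : ∀ᶠ s : ℝ in 𝓝 0, ((t, s) : (Fin d → ℝ) × ℝ) ∈ Metric.ball (0 : (Fin d → ℝ) × ℝ) ρ := by
      have hc2 : Continuous fun s : ℝ => ((t, s) : (Fin d → ℝ) × ℝ) :=
        continuous_const.prodMk continuous_id
      exact hc2.continuousAt.preimage_mem_nhds (Metric.isOpen_ball.mem_nhds (by simpa using ht0))
    have hfc : (f ∘ c) =ᶠ[𝓝 0] fun s => ℓ (γ s) := by
      filter_upwards [hts] with s hs
      change ℓ (φ (g * ι (chartExp B (F i (t, s))))) = ℓ (φ (g' * ι (H.expMem (s • X i))))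
      rw [hkey s hs, map_mul, ← mul_assoc]
    -- the derivative of `γ` at `0` is the Lie derivative
    have hγd : DifferentiableAt ℝ γ 0 := by
      have h1 : γ = (fun Y : H.lie.toSubmodule => φ (g' * ι (H.expMem ⟨(Y : Matrix N N A), Y.2⟩))) ∘
          fun s : ℝ => s • (B i : H.lie.toSubmodule) := by
        funext s
        rfl
      rw [h1]
      have hsm : Differentiable ℝ fun s : ℝ => s • (B i : H.lie.toSubmodule) :=
        differentiable_id.smul_const _
      exact (((hφ g').differentiable (by simp)).comp hsm).differentiableAt
    have hℓγ : deriv (fun s => ℓ (γ s)) 0 = ℓ (deriv γ 0) :=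
      (ℓ.hasFDerivAt.comp_hasDerivAt (0 : ℝ) hγd.hasDerivAt).deriv
    -- assemble
    calc fieldDeriv (fun t => χ t • Ξ₀ i t) f t
        = fderiv ℝ f t (deriv c 0) := by rw [fieldDeriv_apply, hΞt]
      _ = deriv (f ∘ c) 0 := by
          rw [fderiv_comp_deriv (𝕜 := ℝ) 0 (by rw [hc0]; exact (hfs.differentiable (by simp)) t) hcd,
            hc0]
      _ = deriv (fun s => ℓ (γ s)) 0 := hfc.deriv_eq
      _ = ℓ (lieDeriv ι (X i) φ g') := by rw [hℓγ]; rfl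


/-! ### Words and constant-coefficient operators in the chart -/

/-- `X f` only depends on the germ of `f` (local copy of the lemma of
`EllipticReproducingKernel`). [folklore] -/
private theorem fieldDeriv_eventuallyEq' {E : Type*} [NormedAddCommGroup E] [NormedSpace ℝ E]
    (Y : E → E) {f g : E → ℝ} {x : E} (h : f =ᶠ[𝓝 x] g) :
    fieldDeriv Y f =ᶠ[𝓝 x] fieldDeriv Y g := by
  filter_upwards [h.fderiv (𝕜 := ℝ)] with y hy
  simp only [fieldDeriv_apply, hy]

/-- Iterated Lie derivatives of archimedean-smooth functions are archimedean-smooth, granted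
`isArchSmooth_lieDeriv`. Borel–Jacquet 1979, §1.5. [folklore] -/
theorem isArchSmooth_iterLieDeriv_of [FiniteDimensional ℝ A] (hs : isArchSmooth_lieDeriv (ι := ι))
    (w : List H.lie) {φ : G → ℂ} (hφ : IsArchSmooth ι φ) : IsArchSmooth ι (iterLieDeriv ι w φ) := by
  induction w with
  | nil => exact hφ
  | cons X w ih => exact hs X ih

/-- **Words in the chart fields compute iterated Lie derivatives.** If smooth fields `Ξᵢ` on `ℝ^d`
satisfy `Ξᵢ (ℓ ∘ chartFun ι B ψ g) = ℓ ∘ chartFun ι B (Bᵢ ψ) g` on an open set `Ω₀` for all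
archimedean-smooth `ψ` (the output of `exists_chartFields`), and Lie derivatives preserve
archimedean smoothness, then for every word `w = [i₁, …, i_k]`:
`X_w (ℓ ∘ chartFun ι B φ g) = ℓ ∘ chartFun ι B (B_{i₁} ⋯ B_{i_k} φ) g` on `Ω₀` (induction on the
word; the outer field only sees the germ of the inner function).
Borel–Jacquet 1979, §1.5. [folklore] -/
theorem wordDeriv_chartFun_eq [FiniteDimensional ℝ A] {B : Module.Basis (Fin d) ℝ H.lie.toSubmodule}
    {Ξ : Fin d → (Fin d → ℝ) → (Fin d → ℝ)} {Ω₀ : Set (Fin d → ℝ)} (hΩ : IsOpen Ω₀)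
    (hΞ : ∀ (ψ : G → ℂ), IsArchSmooth ι ψ → ∀ (ℓ : ℂ →L[ℝ] ℝ) (g : G) (i : Fin d), ∀ t ∈ Ω₀,
      fieldDeriv (Ξ i) (fun t => ℓ (chartFun ι B ψ g t)) t =
        ℓ (lieDeriv ι (basisLie B i) ψ (g * ι (chartExp B t))))
    (hs : isArchSmooth_lieDeriv (ι := ι)) {φ : G → ℂ} (hφ : IsArchSmooth ι φ) (ℓ : ℂ →L[ℝ] ℝ)
    (g : G) (w : List (Fin d)) :
    ∀ t ∈ Ω₀, wordDeriv Ξ w (fun t => ℓ (chartFun ι B φ g t)) t =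
      ℓ (iterLieDeriv ι (w.map (basisLie B)) φ (g * ι (chartExp B t))) := by
  induction w with
  | nil => intro t _; rfl
  | cons i w ih =>
    intro t ht
    set ψ : G → ℂ := iterLieDeriv ι (w.map (basisLie B)) φ with hψ_def
    have hψ : IsArchSmooth ι ψ := isArchSmooth_iterLieDeriv_of hs _ hφ
    have hev : wordDeriv Ξ w (fun t => ℓ (chartFun ι B φ g t)) =ᶠ[𝓝 t]
        fun t => ℓ (chartFun ι B ψ g t) :=
      Filter.eventually_of_mem (hΩ.mem_nhds ht) fun y hy => ih y hy
    rw [wordDeriv_cons, (fieldDeriv_eventuallyEq' (Ξ i) hev).eq_of_nhds, hΞ ψ hψ ℓ g i t ht]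
    rfl

/-- **Constant-coefficient operators in the chart fields compute word operators on the group**:
under the hypotheses of `wordDeriv_chartFun_eq`, for real constants `c_w`,
`(∑_{w ∈ S} c_w X_w) (ℓ ∘ chartFun ι B φ g) (t) = ℓ (∑_{w ∈ S} c_w (B_w φ)(g ι(chartExp B t)))` for
`t ∈ Ω₀`. [folklore] -/
theorem smoothDiffOp_chartFun_eq [FiniteDimensional ℝ A]
    {B : Module.Basis (Fin d) ℝ H.lie.toSubmodule} {Ξ : Fin d → (Fin d → ℝ) → (Fin d → ℝ)}
    {Ω₀ : Set (Fin d → ℝ)} (hΩ : IsOpen Ω₀)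
    (hΞ : ∀ (ψ : G → ℂ), IsArchSmooth ι ψ → ∀ (ℓ : ℂ →L[ℝ] ℝ) (g : G) (i : Fin d), ∀ t ∈ Ω₀,
      fieldDeriv (Ξ i) (fun t => ℓ (chartFun ι B ψ g t)) t =
        ℓ (lieDeriv ι (basisLie B i) ψ (g * ι (chartExp B t))))
    (hs : isArchSmooth_lieDeriv (ι := ι)) {φ : G → ℂ} (hφ : IsArchSmooth ι φ) (ℓ : ℂ →L[ℝ] ℝ)
    (g : G) (S : Finset (List (Fin d))) (c : List (Fin d) → ℝ) :
    ∀ t ∈ Ω₀, smoothDiffOp Ξ S (fun w _ => c w) (fun t => ℓ (chartFun ι B φ g t)) t =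
      ℓ (∑ w ∈ S, (c w : ℂ) * iterLieDeriv ι (w.map (basisLie B)) φ (g * ι (chartExp B t))) := by
  intro t ht
  unfold smoothDiffOp
  rw [map_sum]
  refine Finset.sum_congr rfl fun w _ => ?_
  rw [wordDeriv_chartFun_eq hΩ hΞ hs hφ ℓ g w t ht, ← Complex.real_smul, map_smul, smul_eq_mul]

/-- **A function annihilated by a constant-coefficient word operator on the group solves the
transported equation in the chart**: if `∑_{w ∈ S} c_w B_w φ = 0` on `G` then
`(∑_{w ∈ S} c_w X_w) (ℓ ∘ chartFun ι B φ g) = 0` on `Ω₀`, for every `g` and every real-linear `ℓ`.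
[folklore] -/
theorem smoothDiffOp_chartFun_eq_zero [FiniteDimensional ℝ A]
    {B : Module.Basis (Fin d) ℝ H.lie.toSubmodule} {Ξ : Fin d → (Fin d → ℝ) → (Fin d → ℝ)}
    {Ω₀ : Set (Fin d → ℝ)} (hΩ : IsOpen Ω₀)
    (hΞ : ∀ (ψ : G → ℂ), IsArchSmooth ι ψ → ∀ (ℓ : ℂ →L[ℝ] ℝ) (g : G) (i : Fin d), ∀ t ∈ Ω₀,
      fieldDeriv (Ξ i) (fun t => ℓ (chartFun ι B ψ g t)) t =
        ℓ (lieDeriv ι (basisLie B i) ψ (g * ι (chartExp B t))))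
    (hs : isArchSmooth_lieDeriv (ι := ι)) {φ : G → ℂ} (hφ : IsArchSmooth ι φ)
    {S : Finset (List (Fin d))} {c : List (Fin d) → ℝ}
    (hann : ∀ x : G, ∑ w ∈ S, (c w : ℂ) * iterLieDeriv ι (w.map (basisLie B)) φ x = 0)
    (ℓ : ℂ →L[ℝ] ℝ) (g : G) :
    ∀ t ∈ Ω₀, smoothDiffOp Ξ S (fun w _ => c w) (fun t => ℓ (chartFun ι B φ g t)) t = 0 := by
  intro t ht
  rw [smoothDiffOp_chartFun_eq hΩ hΞ hs hφ ℓ g S c t ht, hann, map_zero]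

/-! ### Left translations in the chart and the derivative of a reproducing identity -/

/-- A compact subset of an open ball centred at `0` lies in a strictly smaller closed ball of
positive radius. [folklore] -/
private theorem exists_radius_lt {E : Type*} [NormedAddCommGroup E] {K : Set E} (hK : IsCompact K)
    {ρ : ℝ} (hρ : 0 < ρ) (hKρ : K ⊆ Metric.ball 0 ρ) :
    ∃ r : ℝ, 0 < r ∧ r < ρ ∧ K ⊆ Metric.closedBall 0 r := by
  rcases K.eq_empty_or_nonempty with rfl | hne
  · exact ⟨ρ / 2, by positivity, by linarith, by simp⟩
  · obtain ⟨t₀, ht₀, hmax⟩ := hK.exists_isMaxOn hne continuous_norm.continuousOn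
    have h0 : ‖t₀‖ < ρ := by simpa using hKρ ht₀
    refine ⟨(‖t₀‖ + ρ) / 2, by positivity, by linarith, fun t ht => ?_⟩
    rw [Metric.mem_closedBall, dist_zero_right]
    have h1 : ‖t‖ ≤ ‖t₀‖ := hmax ht
    linarith

set_option backward.isDefEq.respectTransparency false in
open scoped Matrix.Norms.Operator in
open MeasureTheory in
/-- **The Lie derivative of a function reproduced in the chart is an integral of its values against
a fixed compactly supported kernel, hence bounded by their supremum.** Let `H` have full Lie
algebra (finite-dimensional coefficients), `B` a basis of `𝔤`, `X ∈ 𝔤`. There is `ρ₁ > 0` such that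
for every `α ∈ C_c^∞(ℝ^d)` supported in the ball `‖t‖ < ρ₁` there is a constant `C ≥ 0` with the
following property: if `φ : G → ℂ` is smooth in the archimedean variable and, for `|s| < ρ₁`,
`φ (g ι(exp sX)) = ∫ α(t) φ (g ι(exp sX) ι(chartExp B t)) dt` (a reproducing identity along the
one-parameter group), then `‖(X φ)(g)‖ ≤ C · M` whenever `‖φ (g ι(chartExp B t))‖ ≤ M` on the support
of `α`. Mechanism: `exp(sX) chartExp B t = chartExp B (c(s, t))` with `c` smooth near `s = 0` and
`c(0, t) = t` (the logarithm of an element of `H` near `1` lies in `𝔤`,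
`RealMatrixGroup.eventually_nhds_one_log_mem`), so one may differentiate under the integral sign
(`hasDerivAt_integral_of_dominated_loc_of_deriv_le`) and integrate by parts against the smooth field
`Θ(t) = ∂ₛ|₀ c(s, t)` (`integral_fieldDeriv_mul'`): `(X φ)(g) = ∫ (ᵗΘ α)(t) φ (g ι(chartExp B t)) dt`,
`C = ∫ |ᵗΘ α|`. Borel 1997, 2.1 and Cor. 5.3; Harish-Chandra 1966, §8. [cite: Borel1997, 2.1] -/
theorem exists_norm_lieDeriv_le_of_reproducing [FiniteDimensional ℝ A]
    (hreg : ∀ X : Matrix N N A, (∀ t : ℝ, expGL (t • X) ∈ H.carrier) → X ∈ H.lie)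
    (B : Module.Basis (Fin d) ℝ H.lie.toSubmodule) (X : H.lie) :
    ∃ ρ₁ : ℝ, 0 < ρ₁ ∧ ∀ (α : (Fin d → ℝ) → ℝ), ContDiff ℝ ∞ α → HasCompactSupport α →
      tsupport α ⊆ Metric.ball 0 ρ₁ →
      ∃ C : ℝ, 0 ≤ C ∧ ∀ (φ : G → ℂ), IsArchSmooth ι φ → ∀ (g : G) (M : ℝ),
        (∀ s : ℝ, |s| < ρ₁ → φ (g * ι (H.expMem (s • X))) =
            ∫ t, (α t : ℂ) * chartFun ι B φ (g * ι (H.expMem (s • X))) t) →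
        (∀ t ∈ tsupport α, ‖chartFun ι B φ g t‖ ≤ M) →
        ‖lieDeriv ι X φ g‖ ≤ C * M := by
  -- the linear chart `Λ : ℝ^d ≃ 𝔤`, a projection `π`, a logarithm
  set Λ : (Fin d → ℝ) →L[ℝ] H.lie.toSubmodule :=
    LinearMap.toContinuousLinearMap
      (B.equivFun.symm : (Fin d → ℝ) →ₗ[ℝ] H.lie.toSubmodule) with hΛ_def
  set Λi : H.lie.toSubmodule →L[ℝ] (Fin d → ℝ) :=
    LinearMap.toContinuousLinearMap
      (B.equivFun : H.lie.toSubmodule →ₗ[ℝ] (Fin d → ℝ)) with hΛi_def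
  have hΛiΛ : ∀ t, Λi (Λ t) = t := fun t => B.equivFun.apply_symm_apply t
  have hΛΛi : ∀ Y, Λ (Λi Y) = Y := fun Y => B.equivFun.symm_apply_apply Y
  have hΛ_chart : ∀ u, chartExp B u = H.expMem ⟨((Λ u : H.lie.toSubmodule) : Matrix N N A),
      (Λ u).2⟩ := fun u => rfl
  obtain ⟨q, hpq⟩ := Submodule.exists_isCompl (H.lie.toSubmodule : Submodule ℝ (Matrix N N A))
  let πl : Matrix N N A →ₗ[ℝ] H.lie.toSubmodule := H.lie.toSubmodule.projectionOnto q hpq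
  let π : Matrix N N A →L[ℝ] H.lie.toSubmodule := ⟨πl, πl.continuous_of_finiteDimensional⟩
  have hπ : ∀ {x : Matrix N N A} (hx : x ∈ H.lie.toSubmodule), π x = ⟨x, hx⟩ := fun hx =>
    Submodule.projectionOnto_apply_of_mem_left hpq hx
  obtain ⟨log, hlogsm, -, hleft⟩ := exists_log_contDiffAt_nhds_one (A := A) (N := N)
  have hexp : ContDiff ℝ ∞ (NormedSpace.exp : Matrix N N A → Matrix N N A) :=
    contDiff_iff_contDiffAt.2 fun M => (NormedSpace.exp_analytic (𝕂 := ℝ) M).contDiffAt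
  have hsub : ContDiff ℝ ∞ (fun Y : H.lie.toSubmodule => (Y : Matrix N N A)) :=
    H.lie.toSubmodule.subtypeL.contDiff
  -- `P (s, t) = exp(sX) exp(Λ t)`, the same element `Q (s, t) ∈ H`, and `c (s, t) = Λ⁻¹ π log P`
  set P : ℝ × (Fin d → ℝ) → Matrix N N A := fun p =>
    NormedSpace.exp (p.1 • (X : Matrix N N A)) *
      NormedSpace.exp ((Λ p.2 : H.lie.toSubmodule) : Matrix N N A) with hP_def
  set Q : ℝ × (Fin d → ℝ) → H.carrier := fun p => H.expMem (p.1 • X) * chartExp B p.2 with hQ_def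
  have hPQ : ∀ p, (((Q p : H.carrier) : GL N A) : Matrix N N A) = P p := fun p => rfl
  set c : ℝ × (Fin d → ℝ) → (Fin d → ℝ) := fun p => Λi (π (log (P p))) with hc_def
  have hPc : ContDiff ℝ ∞ P :=
    (hexp.comp (contDiff_fst.smul contDiff_const)).mul
      (hexp.comp (hsub.comp (Λ.contDiff.comp contDiff_snd)))
  have hexpX0 : H.expMem ((0 : ℝ) • X) = 1 := by
    refine Subtype.ext (Units.ext ?_)
    change NormedSpace.exp ((((0 : ℝ) • X : H.lie)) : Matrix N N A) = 1
    rw [show ((((0 : ℝ) • X : H.lie)) : Matrix N N A) = (0 : ℝ) • (X : Matrix N N A) from rfl,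
      zero_smul, NormedSpace.exp_zero]
  have hQc : Continuous Q :=
    ((continuous_expMem_smul X).comp continuous_fst).mul ((continuous_chartExp B).comp continuous_snd)
  have hQ0 : Q 0 = 1 := by
    simp only [hQ_def, Prod.fst_zero, Prod.snd_zero, chartExp_zero, mul_one]
    exact hexpX0
  have hgood : ∀ᶠ p in 𝓝 (0 : ℝ × (Fin d → ℝ)),
      ContDiffAt ℝ ∞ log (P p) ∧
      (log (P p) ∈ H.lie ∧ expGL (log (P p)) = ((Q p : H.carrier) : GL N A)) ∧
      log (NormedSpace.exp ((Λ p.2 : H.lie.toSubmodule) : Matrix N N A)) =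
        ((Λ p.2 : H.lie.toSubmodule) : Matrix N N A) := by
    refine Filter.Eventually.and ?_ (Filter.Eventually.and ?_ ?_)
    · have ht : Tendsto P (𝓝 0) (𝓝 1) := by
        have h1 := hPc.continuous.tendsto 0
        have h0 : P 0 = 1 := by rw [← hPQ, hQ0]; rfl
        rwa [h0] at h1
      exact ht.eventually hlogsm
    · have ht : Tendsto Q (𝓝 0) (𝓝 1) := by
        have := hQc.tendsto 0
        rwa [hQ0] at this
      exact ht.eventually (H.eventually_nhds_one_log_mem hreg hleft)
    · have hc2 : Continuous fun p : ℝ × (Fin d → ℝ) =>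
          ((Λ p.2 : H.lie.toSubmodule) : Matrix N N A) :=
        continuous_subtype_val.comp (Λ.continuous.comp continuous_snd)
      have ht : Tendsto (fun p : ℝ × (Fin d → ℝ) => ((Λ p.2 : H.lie.toSubmodule) : Matrix N N A))
          (𝓝 0) (𝓝 0) := by
        have := hc2.tendsto 0
        simpa using this
      exact ht.eventually hleft
  obtain ⟨ρ, hρ, hρgood⟩ := Metric.eventually_nhds_iff_ball.1 hgood
  have hball : ∀ {s : ℝ} {t : Fin d → ℝ}, |s| < ρ → ‖t‖ < ρ →
      ((s, t) : ℝ × (Fin d → ℝ)) ∈ Metric.ball (0 : ℝ × (Fin d → ℝ)) ρ := by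
    intro s t hs ht
    rw [Metric.mem_ball, dist_zero_right, Prod.norm_def, max_lt_iff]
    exact ⟨by simpa [Real.norm_eq_abs] using hs, ht⟩
  -- (c1) smoothness, (c2) `c (0, t) = t`, (c3) `exp(sX) chartExp t = chartExp (c (s, t))`
  have hc1 : ∀ p ∈ Metric.ball (0 : ℝ × (Fin d → ℝ)) ρ, ContDiffAt ℝ ∞ c p := fun p hp =>
    Λi.contDiff.contDiffAt.comp p
      (π.contDiff.contDiffAt.comp p ((hρgood p hp).1.comp p hPc.contDiffAt))
  have hc2 : ∀ t : Fin d → ℝ, ‖t‖ < ρ → c (0, t) = t := by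
    intro t ht
    have hp := hball (s := 0) (by simpa using hρ) ht
    change Λi (π (log (P (0, t)))) = t
    have hP0 : P (0, t) = NormedSpace.exp ((Λ t : H.lie.toSubmodule) : Matrix N N A) := by
      simp only [hP_def, zero_smul, NormedSpace.exp_zero, one_mul]
    rw [hP0, (hρgood _ hp).2.2, hπ (Λ t).2]
    exact hΛiΛ t
  have hc3 : ∀ p ∈ Metric.ball (0 : ℝ × (Fin d → ℝ)) ρ,
      chartExp B (c p) = H.expMem (p.1 • X) * chartExp B p.2 := by
    intro p hp
    obtain ⟨hmem, hexplog⟩ := (hρgood p hp).2.1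
    refine Subtype.ext (Units.ext ?_)
    have h1 : Λ (c p) = ⟨log (P p), hmem⟩ := by
      change Λ (Λi (π (log (P p)))) = _
      rw [hΛΛi, hπ hmem]
    rw [hΛ_chart, RealMatrixGroup.coe_expMem]
    change (expGL (((Λ (c p) : H.lie.toSubmodule)) : Matrix N N A) : Matrix N N A) = _
    rw [h1]
    change (expGL (log (P p)) : Matrix N N A) = (((Q p : H.carrier) : GL N A) : Matrix N N A)
    rw [hexplog]
  -- the raw field `θ₀ t = ∂ₛ|₀ c (s, t)`, smooth for `‖t‖ < ρ`
  set θ₀ : (Fin d → ℝ) → (Fin d → ℝ) := fun t => fderiv ℝ (fun s : ℝ => c (s, t)) 0 1 with hθ₀_def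
  have hθ₀sm : ∀ t : Fin d → ℝ, ‖t‖ < ρ → ContDiffAt ℝ ∞ θ₀ t := by
    intro t ht
    have hmem := hball (s := 0) (by simpa using hρ) ht
    have hA : ContDiffAt ℝ ∞ (Function.uncurry fun (t : Fin d → ℝ) (s : ℝ) => c (s, t)) (t, 0) := by
      have : (Function.uncurry fun (t : Fin d → ℝ) (s : ℝ) => c (s, t)) =
          c ∘ fun p : (Fin d → ℝ) × ℝ => (p.2, p.1) := by
        funext p; rfl
      rw [this]
      exact (hc1 _ hmem).comp (t, 0) (contDiff_snd.prodMk contDiff_fst).contDiffAt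
    have hB : ContDiffAt ℝ ∞ (fun t : Fin d → ℝ => fderiv ℝ (fun s : ℝ => c (s, t)) 0) t :=
      ContDiffAt.fderiv (𝕜 := ℝ) (n := ∞) (m := ∞) (f := fun t s => c (s, t))
        (g := fun _ => (0 : ℝ)) hA contDiffAt_const (le_of_eq rfl)
    exact hB.clm_apply contDiffAt_const
  refine ⟨ρ, hρ, fun α hαs hαc hαρ => ?_⟩
  -- Part 2: the kernel `α` is given; globalise the field on its support
  obtain ⟨r, hr0, hrρ, hαr⟩ := exists_radius_lt hαc hρ hαρ
  let η : ContDiffBump (0 : Fin d → ℝ) := ⟨r, (r + ρ) / 2, hr0, by linarith⟩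
  have hη_one : ∀ t ∈ tsupport α, η t = 1 := fun t ht => η.one_of_mem_closedBall (hαr ht)
  set Θ : (Fin d → ℝ) → (Fin d → ℝ) := fun t => η t • θ₀ t with hΘ_def
  have hΘs : ContDiff ℝ ∞ Θ := by
    refine contDiff_iff_contDiffAt.2 fun t => ?_
    by_cases ht : ‖t‖ < ρ
    · exact (η.contDiff.contDiffAt).smul (hθ₀sm t ht)
    · have hnot : t ∉ tsupport (η : (Fin d → ℝ) → ℝ) := by
        rw [η.tsupport_eq, Metric.mem_closedBall, dist_zero_right, not_le]
        change (r + ρ) / 2 < ‖t‖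
        linarith [not_lt.1 ht]
      have hev : Θ =ᶠ[𝓝 t] fun _ => 0 := by
        filter_upwards [notMem_tsupport_iff_eventuallyEq.1 hnot] with y hy
        simp [hΘ_def, hy]
      exact (contDiffAt_const (c := (0 : Fin d → ℝ))).congr_of_eventuallyEq hev
  have hΘ_eq : ∀ t ∈ tsupport α, Θ t = θ₀ t := fun t ht => by
    rw [hΘ_def]
    simp only [hη_one t ht, one_smul]
  -- the constant
  set C : ℝ := ∫ t, |fieldTranspose Θ α t| with hC_def
  have hC0 : 0 ≤ C := integral_nonneg fun t => abs_nonneg _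
  refine ⟨C, hC0, fun φ hφ g M hrep hM => ?_⟩
  -- Part 3: the computation for `φ`, `g`
  have hα_ball : ∀ t ∈ tsupport α, ‖t‖ < ρ := fun t ht => by simpa using hαρ ht
  set v : (Fin d → ℝ) → ℂ := chartFun ι B φ g with hv_def
  have hvs : ContDiff ℝ ∞ v := contDiff_chartFun B hφ g
  have hvd : Differentiable ℝ v := hvs.differentiable (by simp)
  -- the two-variable function `W = v ∘ c` and the integrands
  set W : ℝ × (Fin d → ℝ) → ℂ := fun p => v (c p) with hW_def
  have hWsm : ∀ p ∈ Metric.ball (0 : ℝ × (Fin d → ℝ)) ρ, ContDiffAt ℝ ∞ W p := fun p hp =>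
    hvs.contDiffAt.comp p (hc1 p hp)
  set Fi : ℝ → (Fin d → ℝ) → ℂ := fun s t => (α t : ℂ) * W (s, t) with hFi_def
  set Fi' : ℝ → (Fin d → ℝ) → ℂ := fun s t => (α t : ℂ) * fderiv ℝ W (s, t) (1, 0) with hFi'_def
  -- where `α t ≠ 0`, the point `(s, t)` is good for `|s| < ρ`
  have hgoodst : ∀ {s : ℝ} {t : Fin d → ℝ}, |s| < ρ → α t ≠ 0 →
      ((s, t) : ℝ × (Fin d → ℝ)) ∈ Metric.ball (0 : ℝ × (Fin d → ℝ)) ρ := fun hs ht =>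
    hball hs (hα_ball _ (subset_tsupport _ ht))
  -- (A) the reproducing identity in terms of `Fi`
  have hA : ∀ s : ℝ, |s| < ρ → φ (g * ι (H.expMem (s • X))) = ∫ t, Fi s t := by
    intro s hs
    rw [hrep s hs]
    refine integral_congr_ae (Eventually.of_forall fun t => ?_)
    change (α t : ℂ) * chartFun ι B φ (g * ι (H.expMem (s • X))) t = (α t : ℂ) * v (c (s, t))
    by_cases hαt : α t = 0
    · simp [hαt]
    · congr 1
      change φ (g * ι (H.expMem (s • X)) * ι (chartExp B t)) = φ (g * ι (chartExp B (c (s, t))))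
      rw [hc3 _ (hgoodst hs hαt), map_mul, mul_assoc]
  -- continuity of the integrands for `|s| < ρ`
  have hFic : ∀ s : ℝ, |s| < ρ → Continuous (Fi s) := by
    intro s hs
    refine continuous_iff_continuousAt.2 fun t => ?_
    by_cases hαt : t ∈ tsupport α
    · have hp := hball hs (hα_ball t hαt)
      exact (Complex.continuous_ofReal.continuousAt.comp hαs.continuous.continuousAt).mul
        ((hWsm _ hp).continuousAt.comp (continuousAt_const.prodMk continuousAt_id))
    · have hev : Fi s =ᶠ[𝓝 t] fun _ => 0 := by
        filter_upwards [notMem_tsupport_iff_eventuallyEq.1 hαt] with y hy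
        simp [hFi_def, hy]
      exact continuousAt_const.congr_of_eventuallyEq hev
  have hfderivW : ∀ p ∈ Metric.ball (0 : ℝ × (Fin d → ℝ)) ρ,
      ContinuousAt (fun p => fderiv ℝ W p) p := fun p hp =>
    ((hWsm p hp).fderiv_right (m := ∞) (by exact_mod_cast le_top)).continuousAt
  have hFi'c_on : ContinuousOn (Function.uncurry Fi')
      (Metric.ball (0 : ℝ) ρ ×ˢ (univ : Set (Fin d → ℝ))) := by
    rintro ⟨s, t⟩ ⟨hs, -⟩
    rw [Metric.mem_ball, dist_zero_right, Real.norm_eq_abs] at hs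
    refine ContinuousAt.continuousWithinAt ?_
    change ContinuousAt (fun p : ℝ × (Fin d → ℝ) => (α p.2 : ℂ) * fderiv ℝ W (p.1, p.2) (1, 0)) (s, t)
    by_cases hαt : t ∈ tsupport α
    · have hp := hball hs (hα_ball t hαt)
      refine ((Complex.continuous_ofReal.comp hαs.continuous).continuousAt.comp
        continuousAt_snd).mul ?_
      have h1 : ContinuousAt (fun p : ℝ × (Fin d → ℝ) => fderiv ℝ W p) (s, t) := hfderivW _ hp
      simpa using h1.clm_apply continuousAt_const
    · have hev : (fun p : ℝ × (Fin d → ℝ) => (α p.2 : ℂ) * fderiv ℝ W (p.1, p.2) (1, 0)) =ᶠ[𝓝 (s, t)]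
          fun _ => 0 := by
        have h2 : ∀ᶠ p : ℝ × (Fin d → ℝ) in 𝓝 (s, t), α p.2 = 0 :=
          (continuous_snd.continuousAt (x := (s, t))).eventually
            (notMem_tsupport_iff_eventuallyEq.1 hαt)
        filter_upwards [h2] with p hp
        simp [hp]
      exact continuousAt_const.congr_of_eventuallyEq hev
  have hFi'c : ∀ s : ℝ, |s| < ρ → Continuous (Fi' s) := by
    intro s hs
    have : Fi' s = Function.uncurry Fi' ∘ fun t => (s, t) := by funext t; rfl
    rw [this]
    exact hFi'c_on.comp_continuous (continuous_const.prodMk continuous_id) fun t =>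
      ⟨by simpa [Real.norm_eq_abs] using hs, mem_univ _⟩
  -- compact supports
  have hFisupp : ∀ s, Function.support (Fi s) ⊆ tsupport α := fun s t ht => by
    by_contra h
    exact ht (by simp [hFi_def, image_eq_zero_of_notMem_tsupport h])
  have hFi'supp : ∀ s, Function.support (Fi' s) ⊆ tsupport α := fun s t ht => by
    by_contra h
    exact ht (by simp [hFi'_def, image_eq_zero_of_notMem_tsupport h])
  have hFiint : ∀ s : ℝ, |s| < ρ → Integrable (Fi s) := fun s hs =>
    (hFic s hs).integrable_of_hasCompactSupport (hαc.mono' ((hFisupp s).trans subset_rfl))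
  -- a uniform bound for `Fi'` on `closedBall 0 (ρ/2) × tsupport α`
  obtain ⟨Mb, hMb⟩ : ∃ Mb : ℝ, ∀ p ∈ Metric.closedBall (0 : ℝ) (ρ / 2) ×ˢ tsupport α,
      ‖Function.uncurry Fi' p‖ ≤ Mb :=
    ((isCompact_closedBall (0 : ℝ) (ρ / 2)).prod hαc).exists_bound_of_continuousOn
      (hFi'c_on.mono (prod_mono (Metric.closedBall_subset_ball (by linarith)) (subset_univ _)))
  set bound : (Fin d → ℝ) → ℝ := (tsupport α).indicator fun _ => |Mb| with hbound
  have hbound_int : Integrable bound :=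
    (integrableOn_const (C := |Mb|) (hs := hαc.measure_lt_top.ne)).integrable_indicator
      hαc.measurableSet
  have h_bound : ∀ᵐ t ∂(volume : Measure (Fin d → ℝ)), ∀ s ∈ Metric.ball (0 : ℝ) (ρ / 2),
      ‖Fi' s t‖ ≤ bound t := by
    refine Eventually.of_forall fun t s hs => ?_
    by_cases ht : t ∈ tsupport α
    · rw [hbound, indicator_of_mem ht]
      refine (hMb (s, t) ⟨Metric.ball_subset_closedBall hs, ht⟩).trans (le_abs_self _)
    · have : Fi' s t = 0 := by
        by_contra h
        exact ht (hFi'supp s h)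
      rw [this, norm_zero, hbound]
      exact Set.indicator_nonneg (fun _ _ => abs_nonneg _) _
  -- differentiability in `s`
  have h_diff : ∀ᵐ t ∂(volume : Measure (Fin d → ℝ)), ∀ s ∈ Metric.ball (0 : ℝ) (ρ / 2),
      HasDerivAt (Fi · t) (Fi' s t) s := by
    refine Eventually.of_forall fun t s hs => ?_
    have hs' : |s| < ρ := by
      rw [Metric.mem_ball, dist_zero_right, Real.norm_eq_abs] at hs
      linarith
    by_cases hαt : α t = 0
    · have h1 : (Fi · t) = fun _ => 0 := by funext s'; simp [hFi_def, hαt]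
      have h2 : Fi' s t = 0 := by simp [hFi'_def, hαt]
      rw [h1, h2]
      exact hasDerivAt_const s 0
    · have hp := hgoodst hs' hαt
      have hWd : DifferentiableAt ℝ W (s, t) := (hWsm _ hp).differentiableAt (by simp)
      have hcurve : HasDerivAt (fun s' : ℝ => W (s', t)) (fderiv ℝ W (s, t) (1, 0)) s := by
        have h1 : HasDerivAt (fun s' : ℝ => ((s', t) : ℝ × (Fin d → ℝ))) (1, 0) s :=
          (hasDerivAt_id s).prodMk (hasDerivAt_const s t)
        exact hWd.hasFDerivAt.comp_hasDerivAt s h1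
      exact hcurve.const_mul (α t : ℂ)
  have hmain := hasDerivAt_integral_of_dominated_loc_of_deriv_le
    (μ := (volume : Measure (Fin d → ℝ))) (F := Fi) (F' := Fi') (x₀ := (0 : ℝ)) (bound := bound)
    (Metric.ball_mem_nhds (0 : ℝ) (by positivity : (0 : ℝ) < ρ / 2))
    (by
      filter_upwards [Metric.ball_mem_nhds (0 : ℝ) hρ] with s hs
      rw [Metric.mem_ball, dist_zero_right, Real.norm_eq_abs] at hs
      exact (hFic s hs).aestronglyMeasurable)
    (hFiint 0 (by simpa using hρ)) ((hFi'c 0 (by simpa using hρ)).aestronglyMeasurable)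
    h_bound hbound_int h_diff
  -- (C) `(X φ)(g) = ∫ Fi' 0`
  have hXφ : lieDeriv ι X φ g = ∫ t, Fi' 0 t := by
    have hev : (fun s : ℝ => φ (g * ι (H.expMem (s • X)))) =ᶠ[𝓝 0] fun s => ∫ t, Fi s t := by
      filter_upwards [Metric.ball_mem_nhds (0 : ℝ) hρ] with s hs
      rw [Metric.mem_ball, dist_zero_right, Real.norm_eq_abs] at hs
      exact hA s hs
    change deriv (fun s : ℝ => φ (g * ι (H.expMem (s • X)))) 0 = _
    rw [hev.deriv_eq, hmain.2.deriv]
  -- (D) `Fi' 0 t = α t · Dv(t)[Θ t]`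
  have hD : ∀ t, Fi' 0 t = (α t : ℂ) * fderiv ℝ v t (Θ t) := by
    intro t
    by_cases hαt : α t = 0
    · simp [hFi'_def, hαt]
    · have ht : t ∈ tsupport α := subset_tsupport _ hαt
      have hp := hgoodst (s := 0) (by simpa using hρ) hαt
      have hcd : DifferentiableAt ℝ c (0, t) := (hc1 _ hp).differentiableAt (by simp)
      have h1 : fderiv ℝ W (0, t) = (fderiv ℝ v (c (0, t))).comp (fderiv ℝ c (0, t)) :=
        fderiv_comp _ (hvd _) hcd
      have h2 : fderiv ℝ c (0, t) (1, 0) = θ₀ t := by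
        rw [hθ₀_def]
        change _ = fderiv ℝ (fun s : ℝ => c (s, t)) 0 1
        have h3 : HasFDerivAt (fun s : ℝ => c (s, t))
            ((fderiv ℝ c (0, t)).comp ((ContinuousLinearMap.id ℝ ℝ).prod (0 : ℝ →L[ℝ] (Fin d → ℝ)))) 0 := by
          have h4 : HasFDerivAt (fun s : ℝ => ((s, t) : ℝ × (Fin d → ℝ)))
              ((ContinuousLinearMap.id ℝ ℝ).prod (0 : ℝ →L[ℝ] (Fin d → ℝ))) 0 :=
            (hasFDerivAt_id (0 : ℝ)).prodMk (hasFDerivAt_const t 0)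
          exact hcd.hasFDerivAt.comp (0 : ℝ) h4
        rw [h3.fderiv]
        simp
      rw [hFi'_def]
      change (α t : ℂ) * fderiv ℝ W (0, t) (1, 0) = (α t : ℂ) * fderiv ℝ v t (Θ t)
      rw [h1, ContinuousLinearMap.comp_apply, h2, hc2 t (hα_ball t ht), hΘ_eq t ht]
  -- (E) integrate by parts, separately on real and imaginary parts
  have hvℓ : ∀ ℓ : ℂ →L[ℝ] ℝ, ContDiff ℝ ∞ fun t => ℓ (v t) := fun ℓ => ℓ.contDiff.comp hvs
  have hE : ∀ ℓ : ℂ →L[ℝ] ℝ, ℓ (∫ t, Fi' 0 t) =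
      ∫ t, ℓ (v t) * fieldTranspose Θ α t := by
    intro ℓ
    rw [← ℓ.integral_comp_comm hmain.1]
    have h1 : (fun t => ℓ (Fi' 0 t)) = fun t => fieldDeriv Θ (fun t => ℓ (v t)) t * α t := by
      funext t
      rw [hD t, ← Complex.real_smul, map_smul, smul_eq_mul, mul_comm, fieldDeriv_apply]
      congr 1
      have h2 : fderiv ℝ (fun t => ℓ (v t)) t = (ℓ : ℂ →L[ℝ] ℝ).comp (fderiv ℝ v t) :=
        ((ℓ.hasFDerivAt).comp t (hvd t).hasFDerivAt).fderiv
      rw [h2]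
      rfl
    rw [h1]
    exact integral_fieldDeriv_mul' (hΘs.of_le (by exact_mod_cast le_top))
      ((hvℓ ℓ).of_le (by exact_mod_cast le_top)) (hαs.of_le (by exact_mod_cast le_top)) hαc
  have hE' : ∫ t, Fi' 0 t = ∫ t, (fieldTranspose Θ α t : ℂ) * v t := by
    have hkc : HasCompactSupport (fieldTranspose Θ α) :=
      hαc.mono' ((subset_tsupport _).trans (tsupport_fieldTranspose_subset Θ α))
    have hkc' : HasCompactSupport (((↑) : ℝ → ℂ) ∘ fieldTranspose Θ α) :=
      hkc.comp_left (g := ((↑) : ℝ → ℂ)) Complex.ofReal_zero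
    have hint : Integrable fun t => (fieldTranspose Θ α t : ℂ) * v t :=
      ((Complex.continuous_ofReal.comp (contDiff_fieldTranspose hΘs hαs).continuous).mul
        hvs.continuous).integrable_of_hasCompactSupport hkc'.mul_right
    apply Complex.ext
    · rw [show (∫ t, Fi' 0 t).re = Complex.reCLM (∫ t, Fi' 0 t) from rfl, hE Complex.reCLM,
        show (∫ t, (fieldTranspose Θ α t : ℂ) * v t).re =
          Complex.reCLM (∫ t, (fieldTranspose Θ α t : ℂ) * v t) from rfl,
        ← Complex.reCLM.integral_comp_comm hint]
      refine integral_congr_ae (Eventually.of_forall fun t => ?_)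
      change (v t).re * fieldTranspose Θ α t = ((fieldTranspose Θ α t : ℂ) * v t).re
      rw [Complex.re_ofReal_mul, mul_comm]
    · rw [show (∫ t, Fi' 0 t).im = Complex.imCLM (∫ t, Fi' 0 t) from rfl, hE Complex.imCLM,
        show (∫ t, (fieldTranspose Θ α t : ℂ) * v t).im =
          Complex.imCLM (∫ t, (fieldTranspose Θ α t : ℂ) * v t) from rfl,
        ← Complex.imCLM.integral_comp_comm hint]
      refine integral_congr_ae (Eventually.of_forall fun t => ?_)
      change (v t).im * fieldTranspose Θ α t = ((fieldTranspose Θ α t : ℂ) * v t).im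
      rw [Complex.im_ofReal_mul, mul_comm]
  -- (F) the bound
  rw [hXφ, hE']
  have hptw : ∀ t, ‖(fieldTranspose Θ α t : ℂ) * v t‖ ≤ |fieldTranspose Θ α t| * M := by
    intro t
    by_cases ht : t ∈ tsupport α
    · rw [norm_mul, Complex.norm_real, Real.norm_eq_abs]
      exact mul_le_mul_of_nonneg_left (hM t ht) (abs_nonneg _)
    · have h0 : fieldTranspose Θ α t = 0 :=
        image_eq_zero_of_notMem_tsupport fun h => ht (tsupport_fieldTranspose_subset Θ α h)
      simp [h0]
  have hkc2 : HasCompactSupport ((fun x : ℝ => |x|) ∘ fieldTranspose Θ α) :=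
    (hαc.mono' ((subset_tsupport _).trans (tsupport_fieldTranspose_subset Θ α))).comp_left
      (g := fun x : ℝ => |x|) abs_zero
  have hbint : Integrable fun t => |fieldTranspose Θ α t| * M :=
    ((continuous_abs.comp (contDiff_fieldTranspose hΘs hαs).continuous).mul
      continuous_const).integrable_of_hasCompactSupport hkc2.mul_right
  calc ‖∫ t, (fieldTranspose Θ α t : ℂ) * v t‖ ≤ ∫ t, |fieldTranspose Θ α t| * M :=
        norm_integral_le_of_norm_le hbint (Eventually.of_forall hptw)
    _ = C * M := by rw [hC_def, integral_mul_const]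

end Literature.NumberTheory.Automorphic
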